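import Summits.QuantumAdvantage.QuantumAdvantage.Theorems.CharDialFormJuntaC
import Summits.QuantumAdvantage.QuantumAdvantage.Theorems.CharDialJLinSlice

/-! # CharDialFormJuntaD — part 4/6 (mechanical split for landing of `CharDialFormJunta`; content verbatim; scopes re-opened with their variables) -/

noncomputable section
open Finset

namespace Summit.QuantumAdvantage.AdviceFreeQNC0.WindowCounter
open Summit.QuantumAdvantage.AdviceFreeQNC0

section FormSparse
open AffBells22 Literature.Computability.MetaComplexity Literature.Computability.MetaComplexity.Smolensky
variable (p : ℕ) [Fact p.Prime] {n : ℕ}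

/-- on a subcube over `W ⊇ supp a` the form value is constant. -/
theorem linF_merge {a : Fin n → ZMod p} {W : Finset (Fin n)} (hW : ∀ i, i ∉ W → a i = 0) (b u : Fin n → Bool) :
    linF p a (subcubeMerge W b u) = linF p a (subcubeMerge W b fun _ => false) := by
  unfold linF
  refine sum_congr rfl fun i _ => ?_
  by_cases hi : i ∈ W
  · simp [subcubeMerge, hi]
  · simp [subcubeMerge, hi, hW i hi]

/-- a window of radius `ℓ` around a cut has at most `2ℓ` positions. -/
theorem card_window_le (ℓ : ℕ) (g : Fin (n + 1)) :
    (univ.filter fun i : Fin n => g.val ≤ i.val + ℓ ∧ i.val < g.val + ℓ).card ≤ 2 * ℓ := by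
  calc _ ≤ (Ico (g.val - ℓ) (g.val + ℓ)).card :=
        card_le_card_of_injOn (fun i : Fin n => i.val)
          (fun i hi => by
            have hi' := (mem_filter.1 (mem_coe.1 hi)).2
            simp only [mem_coe, mem_Ico]
            omega)
          (fun i _ j _ h => Fin.ext h)
    _ ≤ 2 * ℓ := by rw [Nat.card_Ico]; omega

/-- **SPARSE directions**: the form dial over window-`(log₂ n)^C` tables loses whenever `2·#{i : a_i ≠ 0} ≤ n`
(ONE `θ₁ < 1` for all such directions and all `C`; no primality needed). -/
theorem form_sparse_hard : ∃ θ₁ : ℝ, θ₁ < 1 ∧ ∀ C : ℕ, ∃ n₀ : ℕ, ∀ n ≥ n₀, ∀ (c : ℕ) (a : Fin n → ZMod p)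
    (Y : ZMod p → Fin (n + 1) → (Fin n → Bool) → Bool), (∀ s, WindowLocal (Nat.log 2 n ^ C) (Y s)) →
      2 * (univ.filter fun i : Fin n => a i ≠ 0).card ≤ n →
        (#{u : Fin n → Bool | ringWinU c (formStrat p a Y) u = true} : ℝ) ≤ θ₁ * 2 ^ n := by
  obtain ⟨θ, hθ, H⟩ := walkHardAllSubcube (δ₀ := 1 / 2) (by norm_num)
  refine ⟨θ, hθ, fun C => ?_⟩
  obtain ⟨n₀, hn₀⟩ := H (C + 1)
  refine ⟨max n₀ 4, fun n hn c a Y hY hsp => ?_⟩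
  set ℓ := Nat.log 2 n ^ C with hℓ
  set W : Finset (Fin n) := univ.filter fun i : Fin n => a i ≠ 0 with hWdef
  have hW0 : ∀ i, i ∉ W → a i = 0 := fun i hi => by
    by_contra h; exact hi (mem_filter.2 ⟨mem_univ _, h⟩)
  have hWcard : (W.card : ℝ) ≤ 1 / 2 * n := by
    have h' : ((2 * W.card : ℕ) : ℝ) ≤ n := by exact_mod_cast hsp
    push_cast at h'; linarith
  have hn4 : 4 ≤ n := le_trans (le_max_right _ _) hn
  have hlog : 2 ≤ Nat.log 2 n := Nat.le_log_of_pow_le one_lt_two (by norm_num; omega)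
  have hwin : ∀ g : Fin (n + 1),
      (univ.filter fun i : Fin n => g.val ≤ i.val + ℓ ∧ i.val < g.val + ℓ).card ≤ Nat.log 2 n ^ (C + 1) := by
    intro g
    calc _ ≤ 2 * ℓ := card_window_le ℓ g
      _ ≤ Nat.log 2 n ^ (C + 1) := by rw [pow_succ]; nlinarith [hlog, Nat.zero_le ℓ]
  -- per-subcube bound
  have hcube : ∀ b : Fin n → Bool,
      ((univ.filter fun u : Fin n → Bool => ringWinU c (formStrat p a Y) (subcubeMerge W b u) = true).card : ℝ) ≤
        θ * 2 ^ n := by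
    intro b
    refine hn₀ n (le_trans (le_max_left _ _) hn) c W b hWcard (formStrat p a Y) fun g => ?_
    have e : (fun u => formStrat p a Y g (subcubeMerge W b u)) =
        fun u => Y (linF p a (subcubeMerge W b fun _ => false)) g (subcubeMerge W b u) := by
      funext u; simp only [formStrat, linF_merge p hW0]
    rw [e]
    exact BlockFibre37.hasDeg_of_dependsOn _ (hwin g) fun u v huv => hY _ g _ _ fun i hi1 hi2 => by
      by_cases hi : i ∈ W
      · simp [subcubeMerge, hi]
      · simp [subcubeMerge, hi, huv i (mem_filter.2 ⟨mem_univ _, hi1, hi2⟩)]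
  -- sum over the subcubes
  have hsum := JLinPeel.sum_card_subcube W (fun v : Fin n → Bool => ringWinU c (formStrat p a Y) v = true)
  have hsumR : ((2 ^ n * #{u : Fin n → Bool | ringWinU c (formStrat p a Y) u = true} : ℕ) : ℝ) =
      ∑ b : Fin n → Bool,
        ((univ.filter fun u : Fin n → Bool => ringWinU c (formStrat p a Y) (subcubeMerge W b u) = true).card : ℝ) := by
    rw [← hsum]; push_cast; rfl
  have hle : ∑ b : Fin n → Bool,
      ((univ.filter fun u : Fin n → Bool => ringWinU c (formStrat p a Y) (subcubeMerge W b u) = true).card : ℝ) ≤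
        ∑ _b : Fin n → Bool, θ * 2 ^ n := sum_le_sum fun b _ => hcube b
  rw [sum_const, card_univ, Fintype.card_fun, Fintype.card_bool, Fintype.card_fin, nsmul_eq_mul, ← hsumR] at hle
  push_cast at hle
  have h2n : (0 : ℝ) < 2 ^ n := by positivity
  nlinarith

/-- **MAIN THEOREM (the window ⊕ ONE-FORM rung).**  For every prime `p ≥ 5` there is ONE `θ < 1` such that for every
`C`, eventually in `n`, for EVERY direction `a : Fin n → ZMod p`, every strategy each of whose cuts reads a WINDOW of
`(log₂ n)^C` bits around itself AND the value `⟨a,u⟩ mod p` (through arbitrary tables) wins the walk game on at most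
`θ · 2ⁿ` inputs.  (`a = 1` is `windowCounter_hard`.) -/
theorem formWindow_hard (hp : 5 ≤ p) : ∃ θ : ℝ, θ < 1 ∧ ∀ C : ℕ, ∃ n₀ : ℕ, ∀ n ≥ n₀,
    ∀ (c : ℕ) (a : Fin n → ZMod p) (Y : ZMod p → Fin (n + 1) → (Fin n → Bool) → Bool),
      (∀ s, WindowLocal (Nat.log 2 n ^ C) (Y s)) →
        (#{u : Fin n → Bool | ringWinU c (formStrat p a Y) u = true} : ℝ) ≤ θ * 2 ^ n := by
  obtain ⟨θ₁, hθ₁, H₁⟩ := form_sparse_hard p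
  obtain ⟨θ₀, hθ₀, H₀⟩ := windowLocalHardU
  refine ⟨max θ₁ (θ₀ + (1 - θ₀) / 2), max_lt hθ₁ (by linarith), fun C => ?_⟩
  obtain ⟨n₁, hn₁⟩ := H₁ C
  obtain ⟨n₀, hn₀⟩ := H₀ C
  obtain ⟨n₂, hn₂⟩ := form_reduction p (fun {n} _ y => WindowLocal (Nat.log 2 n ^ C) y)
    ⟨n₀, fun n hn c y hy => hn₀ n hn c y hy⟩ (form_twist_small_dense p hp C) hθ₀
  refine ⟨max n₁ n₂, fun n hn c a Y hY => ?_⟩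
  have h2n : (0 : ℝ) ≤ 2 ^ n := by positivity
  by_cases hsp : 2 * (univ.filter fun i : Fin n => a i ≠ 0).card ≤ n
  · exact le_trans (hn₁ n (le_trans (le_max_left _ _) hn) c a Y hY hsp)
      (mul_le_mul_of_nonneg_right (le_max_left _ _) h2n)
  · push Not at hsp
    exact le_trans (hn₂ n (le_trans (le_max_right _ _) hn) c a Y hsp.le hY)
      (mul_le_mul_of_nonneg_right (le_max_right _ _) h2n)

end FormSparse

/-! ## §I (rev 7) THE BLOCK PRODUCT — form-twisted win sums of ARBITRARY-POSITION junta strategies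

No transfer operator: write `[WIN_y u] = (1 − F(u))/2`, `F(u) = ∏_g sgn(fires_g u)`, and average over overwrites of
`m` disjoint GOOD blocks `B_j = {k_j, k_j+1, k_j+2}` (`a_{k_j} ≠ 0`) that are pairwise NON-INTERACTING (no cut touches
two of them; «`g` touches `B`» = `g` reads a bit of `B` or `g ∈ {k+1, k+2}` sits inside `B`).  CONDITIONED ON THE
WEIGHT CLASSES `wt(X_j) mod 3` of all blocks, `wt u mod 3` and every `wtPrefix_g mod 3` are constant, so the signs of the
cuts touching block `j` depend on `X_j` only: the class-restricted multi-sum has the exact RATIO property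
(`msum_ratio`, from the four-point identity `Qf_exchange`), each block contracts in its good class by `2 − β`
(`msum_bound`), and `Σ_{classes} ∏_j b_j = ∏_j (6 + β)`: **`‖Σ_u F(u) ψ_p(t⟨a,u⟩)‖ ≤ 2ⁿ ((6+β)/8)^m`** (`norm_sum_Qf_le`). -/

section BlockProduct

variable (p : ℕ) [Fact p.Prime] {n : ℕ}

/-! ### block overwrites -/

/-- overwrite the block `{k, k+1, k+2}` of `u` with the pattern `X`. -/
def setBlk (k : ℕ) (X : Fin 3 → Bool) (u : Fin n → Bool) : Fin n → Bool :=
  fun i => if h : k ≤ i.val ∧ i.val < k + 3 then X ⟨i.val - k, by omega⟩ else u i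

/-- the pattern of `u` on the block at `k`. -/
def getBlk (k : ℕ) (hk : k + 3 ≤ n) (u : Fin n → Bool) : Fin 3 → Bool := fun j => u ⟨k + j.val, by omega⟩

/-- CharDialFormJuntaD helper `setBlk_of_not` (decomp-qadv land package; see the module docstring). -/
theorem setBlk_of_not {k : ℕ} (X : Fin 3 → Bool) (u : Fin n → Bool) {i : Fin n}
    (h : ¬ (k ≤ i.val ∧ i.val < k + 3)) : setBlk k X u i = u i := by
  simp [setBlk, h]

/-- CharDialFormJuntaD helper `setBlk_setBlk` (decomp-qadv land package; see the module docstring). -/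
theorem setBlk_setBlk (k : ℕ) (X Y : Fin 3 → Bool) (u : Fin n → Bool) :
    setBlk k X (setBlk k Y u) = setBlk k X u := by
  funext i; unfold setBlk; split_ifs <;> rfl

/-- CharDialFormJuntaD helper `setBlk_comm` (decomp-qadv land package; see the module docstring). -/
theorem setBlk_comm {k k' : ℕ} (hkk : k + 3 ≤ k' ∨ k' + 3 ≤ k) (X Y : Fin 3 → Bool) (u : Fin n → Bool) :
    setBlk k X (setBlk k' Y u) = setBlk k' Y (setBlk k X u) := by
  funext i; unfold setBlk
  split_ifs with h1 h2 <;> first | rfl | omega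

/-- CharDialFormJuntaD helper `setBlk_getBlk` (decomp-qadv land package; see the module docstring). -/
theorem setBlk_getBlk (k : ℕ) (hk : k + 3 ≤ n) (u : Fin n → Bool) : setBlk k (getBlk k hk u) u = u := by
  funext i; unfold setBlk getBlk
  split_ifs with h
  · congr 1; ext; simp only; omega
  · rfl

/-- CharDialFormJuntaD helper `getBlk_setBlk` (decomp-qadv land package; see the module docstring). -/
theorem getBlk_setBlk (k : ℕ) (hk : k + 3 ≤ n) (X : Fin 3 → Bool) (u : Fin n → Bool) :
    getBlk k hk (setBlk k X u) = X := by
  funext j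
  have h : k ≤ k + j.val ∧ k + j.val < k + 3 := ⟨by omega, by omega⟩
  simp only [setBlk, getBlk, dif_pos h]
  congr 1; ext; simp

/-- CharDialFormJuntaD helper `getBlk_setBlk_of_sep` (decomp-qadv land package; see the module docstring). -/
theorem getBlk_setBlk_of_sep {k k' : ℕ} (hk : k + 3 ≤ n) (hkk : k + 3 ≤ k' ∨ k' + 3 ≤ k) (Y : Fin 3 → Bool)
    (u : Fin n → Bool) : getBlk k hk (setBlk k' Y u) = getBlk k hk u := by
  funext j
  have h : ¬ (k' ≤ k + j.val ∧ k + j.val < k' + 3) := by omega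
  simp only [setBlk, getBlk, dif_neg h]

/-- the block as a finset of positions. -/
def blk (k : ℕ) : Finset (Fin n) := univ.filter fun i : Fin n => k ≤ i.val ∧ i.val < k + 3

/-- CharDialFormJuntaD helper `blk_eq_image` (decomp-qadv land package; see the module docstring). -/
theorem blk_eq_image (k : ℕ) (hk : k + 3 ≤ n) :
    (blk k : Finset (Fin n)) = (univ : Finset (Fin 3)).image fun j => (⟨k + j.val, by omega⟩ : Fin n) := by
  ext i
  simp only [blk, mem_filter, mem_univ, true_and, mem_image]
  constructor
  · intro h; exact ⟨⟨i.val - k, by omega⟩, by ext; simp only; omega⟩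
  · rintro ⟨j, rfl⟩; simp only; omega

/-- **block splitting of Boolean-indicator sums**: replacing the block content `getBlk u` by `X`. -/
theorem sum_setBlk_split {M : Type*} [AddCommMonoid M] (k : ℕ) (hk : k + 3 ≤ n) (X : Fin 3 → Bool)
    (u : Fin n → Bool) (G : Fin n → M) :
    (∑ i, if setBlk k X u i = true then G i else 0) + (∑ j : Fin 3, if getBlk k hk u j = true then G ⟨k + j.val, by omega⟩ else 0)
      = (∑ i, if u i = true then G i else 0) + ∑ j : Fin 3, if X j = true then G ⟨k + j.val, by omega⟩ else 0 := by
  have hinj : Set.InjOn (fun j : Fin 3 => (⟨k + j.val, by omega⟩ : Fin n)) (univ : Finset (Fin 3)) := by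
    intro j _ j' _ h; ext; simpa using congrArg Fin.val h
  have split : ∀ v : Fin n → Bool, (∑ i, if v i = true then G i else 0) =
      (∑ i ∈ blk k, if v i = true then G i else 0) + ∑ i ∈ univ.filter (fun i : Fin n => ¬ (k ≤ i.val ∧ i.val < k + 3)),
        if v i = true then G i else 0 := fun v => (sum_filter_add_sum_filter_not _ _ _).symm
  have onblk : ∀ v : Fin n → Bool, (∑ i ∈ blk k, if v i = true then G i else 0) =
      ∑ j : Fin 3, if v ⟨k + j.val, by omega⟩ = true then G ⟨k + j.val, by omega⟩ else 0 := fun v => by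
    rw [blk_eq_image k hk, sum_image hinj]
  have off : (∑ i ∈ univ.filter (fun i : Fin n => ¬ (k ≤ i.val ∧ i.val < k + 3)), if setBlk k X u i = true then G i else 0)
      = ∑ i ∈ univ.filter (fun i : Fin n => ¬ (k ≤ i.val ∧ i.val < k + 3)), if u i = true then G i else 0 :=
    sum_congr rfl fun i hi => by rw [setBlk_of_not X u (mem_filter.1 hi).2]
  have onX : (∑ j : Fin 3, if setBlk k X u ⟨k + j.val, by omega⟩ = true then G ⟨k + j.val, by omega⟩ else 0)
      = ∑ j : Fin 3, if X j = true then G ⟨k + j.val, by omega⟩ else 0 :=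
    sum_congr rfl fun j _ => by
      have : setBlk k X u ⟨k + j.val, by omega⟩ = X j := by
        have h : k ≤ k + j.val ∧ k + j.val < k + 3 := ⟨by omega, by omega⟩
        simp only [setBlk, dif_pos h]; congr 1; ext; simp
      rw [this]
  rw [split (setBlk k X u), split u, onblk, onblk, off, onX]
  simp only [getBlk]
  abel

/-- weights under a block overwrite. -/
theorem wt_setBlk (k : ℕ) (hk : k + 3 ≤ n) (X : Fin 3 → Bool) (u : Fin n → Bool) :
    wt (setBlk k X u) + wt (getBlk k hk u) = wt u + wt X := by
  have h := sum_setBlk_split k hk X u (fun _ => (1 : ℕ))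
  simp only [wt, card_eq_sum_ones, sum_filter]
  simpa using h

/-- prefix weights under a block overwrite: before the block nothing changes, after it the block weight is swapped. -/
theorem wtPrefix_setBlk (k : ℕ) (hk : k + 3 ≤ n) (X : Fin 3 → Bool) (u : Fin n → Bool) (g : ℕ) :
    (g ≤ k → wtPrefix (setBlk k X u) g = wtPrefix u g) ∧
    (k + 3 ≤ g → wtPrefix (setBlk k X u) g + wt (getBlk k hk u) = wtPrefix u g + wt X) := by
  have h := sum_setBlk_split k hk X u (fun i => if i.val < g then (1 : ℕ) else 0)
  have e : ∀ v : Fin n → Bool, wtPrefix v g = ∑ i : Fin n, if v i = true then (if i.val < g then 1 else 0) else 0 := by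
    intro v; unfold wtPrefix; rw [card_eq_sum_ones, sum_filter]
    refine sum_congr rfl fun i _ => ?_
    by_cases h1 : v i = true <;> by_cases h2 : i.val < g <;> simp [h1, h2]
  constructor
  · intro hg
    have z1 : (∑ j : Fin 3, if getBlk k hk u j = true then (if (⟨k + j.val, by omega⟩ : Fin n).val < g then 1 else 0) else 0) = 0 :=
      sum_eq_zero fun j _ => by
        have hj := j.isLt
        have h3 : ¬ (k + j.val < g) := by omega
        simp [h3]
    have z2 : (∑ j : Fin 3, if X j = true then (if (⟨k + j.val, by omega⟩ : Fin n).val < g then 1 else 0) else 0) = 0 :=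
      sum_eq_zero fun j _ => by
        have hj := j.isLt
        have h3 : ¬ (k + j.val < g) := by omega
        simp [h3]
    rw [z1, z2, add_zero, add_zero] at h
    rw [e, e, h]
  · intro hg
    have z1 : (∑ j : Fin 3, if getBlk k hk u j = true then (if (⟨k + j.val, by omega⟩ : Fin n).val < g then 1 else 0) else 0)
        = wt (getBlk k hk u) := by
      rw [wt, card_eq_sum_ones, sum_filter]
      exact sum_congr rfl fun j _ => by
        have hj := j.isLt
        have h3 : k + j.val < g := by omega
        simp [h3]
    have z2 : (∑ j : Fin 3, if X j = true then (if (⟨k + j.val, by omega⟩ : Fin n).val < g then 1 else 0) else 0) = wt X := by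
      rw [wt, card_eq_sum_ones, sum_filter]
      exact sum_congr rfl fun j _ => by
        have hj := j.isLt
        have h3 : k + j.val < g := by omega
        simp [h3]
    rw [z1, z2] at h
    rw [e, e]; exact h

/-- the linear form under a block overwrite. -/
def blkF (a : Fin n → ZMod p) (k : ℕ) (X : Fin 3 → Bool) : ZMod p :=
  ∑ j : Fin 3, if X j = true then aExt p a (k + j.val) else 0


end BlockProduct
end Summit.QuantumAdvantage.AdviceFreeQNC0.WindowCounter
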